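import Mathlib.Algebra.Order.Ring.Pow
import Mathlib.Analysis.Normed.Group.Bounded
import Literature.Analysis.FluidPDE.StationaryEulerWavePackets
import Literature.Analysis.FluidPDE.StationaryEulerAlignedCubes
import Literature.Analysis.FluidPDE.StationaryEulerProfiles
import HarnessLib

/-!
# The two-state localized plane wave (Choffrut–Székelyhidi 2014, Lemma 4), I: construction

Topic `Literature/Analysis/FluidPDE`. Support file of the proof of
`Literature.Analysis.FluidPDE.Torus.ChoffrutSzekelyhidi2014_thm1` (Choffrut–Székelyhidi, SIAM
J. Math. Anal. 46 (2014) = arXiv:1401.4301). Lemma 4 of the paper: for a `Λ`-segment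
`[w₁, w₂]`, `w₂ - w₁ = w̄ ∈ Λ`, `μ₁ w₁ + μ₂ w₂ = 0`, and `ε > 0` there is a compactly supported
smooth subsolution on the cube with values `ε`-close to the segment and equal to `wᵢ` on open
sets `Aᵢ` of measure `≈ μᵢ`. With `t = μ₁` (`w₁ = -(1-t) w̄`, `w₂ = t w̄`) we construct it as
`𝓛_w̄[χ · gₙ(⟪η, ·⟫)]` on the reference cube of the Householder frame of `η` (`|η| = 1`), where

* `χ(x) = Πᵢ B((R x)ᵢ)` is a product plateau cutoff (`= 1` on the plateau
  `{∀ i, (Rx)ᵢ ∈ (1/q, 1 - 1/q)}`, supported in the closed box `[1/(2q), 1 - 1/(2q)]^d`);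
* `gₙ(u) = Σ_{k = n}^{M-n-1} C(M u - k)/M²`, `M = n q`, is a comb of `M - 2n` translated cells
  of `StationaryEulerProfiles.lean` filling exactly the plateau range `[1/q, 1 - 1/q]` of the
  phase `u = ⟪η, x⟫ = (R x)_{i₀}`; `gₙ'' = Σₖ c(M u - k)` is two-valued on the plateaus of the
  cells, `|gₙ| ≤ K/M²`, `|gₙ'| ≤ K/M`.

By the cutoff expansion, `𝓛_w̄[χ gₙ] = (χ gₙ'') w̄ + rem` with `‖rem‖ ≤ C (M₂ K/M² + 2 M₁ K/M)`
(`M₁, M₂` bounds of `∇χ, ∇²χ`, independent of `n`) and `rem = 0` on the plateau: this file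
proves the value statements (i) of Lemma 4 (values near the segment, exact values on the level
sets); the companion file `StationaryEulerTwoStateWaveMeasure.lean` computes the measures of the
level sets and assembles Lemma 4.

## References

* A. Choffrut, L. Székelyhidi Jr., SIAM J. Math. Anal. 46 (2014), Lemma 4.
-/

noncomputable section

open scoped InnerProductSpace ContDiff
open Set Function MeasureTheory Metric
open Literature.Analysis.FunctionSpaces

namespace Literature.Analysis.FluidPDE

namespace StationaryEuler

variable {d : Type*} [Fintype d]

/-! ## Sums of translates of a function supported in `[0, 1]` -/

section Translates

/-- **At most one translate is alive**: if `f` vanishes off `(0,1)` then `Σ_{k ∈ S} f(v - k)`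
is `f(v - ⌊v⌋)` or `0`. [folklore] -/
theorem sum_translate_eq {f : ℝ → ℝ} (hf : ∀ θ, θ ≤ 0 ∨ 1 ≤ θ → f θ = 0) (S : Finset ℤ) (v : ℝ) :
    ∑ k ∈ S, f (v - k) = if ⌊v⌋ ∈ S then f (v - ⌊v⌋) else 0 := by
  have hzero : ∀ k : ℤ, k ≠ ⌊v⌋ → f (v - k) = 0 := by
    intro k hk
    apply hf
    rcases lt_or_gt_of_ne hk with h | h
    · right
      have : (k : ℝ) + 1 ≤ ⌊v⌋ := by exact_mod_cast h
      linarith [Int.floor_le v]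
    · left
      have : (⌊v⌋ : ℝ) + 1 ≤ k := by exact_mod_cast h
      linarith [Int.lt_floor_add_one v]
  split_ifs with h
  · rw [Finset.sum_eq_single_of_mem _ h fun k _ hk => hzero k hk]
  · exact Finset.sum_eq_zero fun k hk => hzero k fun heq => h (heq ▸ hk)

/-- Sums of translates inherit pointwise bounds. [folklore] -/
theorem abs_sum_translate_le {f : ℝ → ℝ} (hf : ∀ θ, θ ≤ 0 ∨ 1 ≤ θ → f θ = 0) {K : ℝ} (hK0 : 0 ≤ K)
    (hK : ∀ θ, |f θ| ≤ K) (S : Finset ℤ) (v : ℝ) : |∑ k ∈ S, f (v - k)| ≤ K := by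
  rw [sum_translate_eq hf]
  split_ifs
  · exact hK _
  · simpa using hK0

/-- Sums of translates inherit membership in an interval containing `0`. [folklore] -/
theorem sum_translate_mem_Icc {f : ℝ → ℝ} (hf : ∀ θ, θ ≤ 0 ∨ 1 ≤ θ → f θ = 0) {a b : ℝ}
    (ha : a ≤ 0) (hb : 0 ≤ b) (hI : ∀ θ, f θ ∈ Icc a b) (S : Finset ℤ) (v : ℝ) :
    ∑ k ∈ S, f (v - k) ∈ Icc a b := by
  rw [sum_translate_eq hf]
  split_ifs
  · exact hI _
  · exact ⟨ha, hb⟩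

/-- If one translate sits at a point of `(0,1)`, the sum is that translate. [folklore] -/
theorem sum_translate_eq_of_mem {f : ℝ → ℝ} (hf : ∀ θ, θ ≤ 0 ∨ 1 ≤ θ → f θ = 0) {S : Finset ℤ}
    {v : ℝ} {k₀ : ℤ} (hk₀ : k₀ ∈ S) (hv : v - k₀ ∈ Ioo (0 : ℝ) 1) :
    ∑ k ∈ S, f (v - k) = f (v - k₀) := by
  have hfl : ⌊v⌋ = k₀ := by
    rw [Int.floor_eq_iff]; constructor <;> linarith [hv.1, hv.2]
  rw [sum_translate_eq hf, hfl, if_pos hk₀]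

end Translates

/-! ## The data of the construction -/

variable (d) in
/-- Data of the two-state wave: a certificate with unit frequency direction, a distinguished
coordinate, a cell profile (weight `t` and waste), the cutoff parameter `q ≥ 3` and the cell
count parameter `n ≥ 1` (`M = n q` cells per unit length). [cite: ChoffrutSzekelyhidi2014, Lemma 4] -/
structure TwoStateData where
  /-- the certified direction -/
  c : WaveCert d
  hη : ‖c.η‖ = 1
  /-- the distinguished coordinate of the Householder frame -/
  i₀ : d
  /-- the cell profile data (`t`, `ε`) -/
  p : Profile.CellData
  /-- the cutoff plateau parameter -/
  q : ℕ
  hq : 3 ≤ q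
  /-- the frequency parameter -/
  n : ℕ
  hn : 1 ≤ n

namespace TwoStateData

variable (D : TwoStateData d)

/-- The number of cells per unit length `M = n q`. [folklore] -/
def M : ℕ := D.n * D.q

/-- The cell indices `k = n, …, M - n - 1`. [folklore] -/
def Kset : Finset ℤ := Finset.Icc (D.n : ℤ) (D.M - D.n - 1)

/-- `q > 0`. [folklore] -/
theorem q_pos : 0 < D.q := lt_of_lt_of_le (by norm_num) D.hq

/-- `M > 0`. [folklore] -/
theorem M_pos : 0 < D.M := Nat.mul_pos D.hn D.q_pos

/-- `M > 0` in `ℝ`. [folklore] -/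
theorem M_pos' : (0 : ℝ) < D.M := by exact_mod_cast D.M_pos

/-- `n / M = 1 / q`. [folklore] -/
theorem n_div_M : (D.n : ℝ) / D.M = 1 / D.q := by
  have hq : (D.q : ℝ) ≠ 0 := by exact_mod_cast D.q_pos.ne'
  have hn : (D.n : ℝ) ≠ 0 := by exact_mod_cast (Nat.one_le_iff_ne_zero.1 D.hn)
  rw [M, Nat.cast_mul]; field_simp

/-! ## The comb -/

/-- The comb `gₙ(u) = Σₖ C(M u - k)/M²`. [cite: ChoffrutSzekelyhidi2014, Lemma 4] -/
def comb (u : ℝ) : ℝ := ∑ k ∈ D.Kset, D.p.cellPot (D.M * u - k) / (D.M : ℝ) ^ 2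

/-- `gₙ'`. [folklore] -/
def comb' (u : ℝ) : ℝ := ∑ k ∈ D.Kset, D.p.cellInt (D.M * u - k) / (D.M : ℝ)

/-- `gₙ'' = Σₖ c(M u - k)`. [folklore] -/
def comb'' (u : ℝ) : ℝ := ∑ k ∈ D.Kset, D.p.cell (D.M * u - k)

/-- Derivative of a translated rescaled profile. [folklore] -/
theorem hasDerivAt_comp_affine {F F' : ℝ → ℝ} (hF : ∀ θ, HasDerivAt F (F' θ) θ) (k : ℤ) (u : ℝ) :
    HasDerivAt (fun u => F (D.M * u - k)) (D.M * F' (D.M * u - k)) u := by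
  have h : HasDerivAt (fun u => F ((D.M : ℝ) * u - k)) (F' ((D.M : ℝ) * u - k) * ((D.M : ℝ) * 1)) u :=
    (hF _).comp u (((hasDerivAt_id' u).const_mul (D.M : ℝ)).sub_const (k : ℝ))
  convert h using 1; ring

/-- `gₙ` has derivative `gₙ'`. [folklore] -/
theorem hasDerivAt_comb (u : ℝ) : HasDerivAt D.comb (D.comb' u) u := by
  have hM := D.M_pos'.ne'
  unfold comb comb'
  have : ∑ k ∈ D.Kset, D.p.cellInt (D.M * u - k) / (D.M : ℝ) =
      ∑ k ∈ D.Kset, D.M * D.p.cellInt (D.M * u - k) / (D.M : ℝ) ^ 2 :=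
    Finset.sum_congr rfl fun k _ => by field_simp
  rw [this]
  exact HasDerivAt.fun_sum fun k _ => (D.hasDerivAt_comp_affine D.p.hasDerivAt_cellPot k u).div_const _

/-- `gₙ'` has derivative `gₙ''`. [folklore] -/
theorem hasDerivAt_comb' (u : ℝ) : HasDerivAt D.comb' (D.comb'' u) u := by
  have hM := D.M_pos'.ne'
  unfold comb' comb''
  have : ∑ k ∈ D.Kset, D.p.cell (D.M * u - k) =
      ∑ k ∈ D.Kset, D.M * D.p.cell (D.M * u - k) / (D.M : ℝ) :=
    Finset.sum_congr rfl fun k _ => by field_simp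
  rw [this]
  exact HasDerivAt.fun_sum fun k _ => (D.hasDerivAt_comp_affine D.p.hasDerivAt_cellInt k u).div_const _

/-- `deriv gₙ = gₙ'`. [folklore] -/
theorem deriv_comb : deriv D.comb = D.comb' := funext fun u => (D.hasDerivAt_comb u).deriv

/-- `deriv (deriv gₙ) = gₙ''`. [folklore] -/
theorem deriv_deriv_comb : deriv (deriv D.comb) = D.comb'' := by
  rw [deriv_comb]; exact funext fun u => (D.hasDerivAt_comb' u).deriv

/-- The comb is smooth. [folklore] -/
theorem contDiff_comb : ContDiff ℝ ∞ D.comb := by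
  unfold comb
  exact ContDiff.sum fun k _ => (D.p.contDiff_cellPot.comp
    ((contDiff_const.mul contDiff_id).sub contDiff_const)).div_const _

/-- **`|gₙ| ≤ K/M²`.** [folklore] -/
theorem abs_comb_le {K : ℝ} (hK0 : 0 ≤ K) (hK : ∀ θ, |D.p.cellPot θ| ≤ K) (u : ℝ) :
    |D.comb u| ≤ K / (D.M : ℝ) ^ 2 := by
  have hM2 : (0 : ℝ) < (D.M : ℝ) ^ 2 := pow_pos D.M_pos' 2
  unfold comb
  rw [← Finset.sum_div, abs_div, abs_of_pos hM2]
  exact div_le_div_of_nonneg_right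
    (abs_sum_translate_le (fun θ h => (D.p.cellPot_cellInt_eq_zero h).1) hK0 hK _ _) hM2.le

/-- **`|gₙ'| ≤ K/M`.** [folklore] -/
theorem abs_comb'_le {K : ℝ} (hK0 : 0 ≤ K) (hK : ∀ θ, |D.p.cellInt θ| ≤ K) (u : ℝ) :
    |D.comb' u| ≤ K / (D.M : ℝ) := by
  unfold comb'
  rw [← Finset.sum_div, abs_div, abs_of_pos D.M_pos']
  exact div_le_div_of_nonneg_right
    (abs_sum_translate_le (fun θ h => (D.p.cellPot_cellInt_eq_zero h).2) hK0 hK _ _) D.M_pos'.le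

/-- The cell vanishes off `(0,1)`. [folklore] -/
theorem cell_eq_zero (θ : ℝ) (h : θ ≤ 0 ∨ 1 ≤ θ) : D.p.cell θ = 0 :=
  h.elim D.p.cell_eq_zero_of_nonpos D.p.cell_eq_zero_of_one_le

/-- **Values of `gₙ''` lie in `[-(1-t), t]`.** [cite: ChoffrutSzekelyhidi2014, Lemma 4] -/
theorem comb''_mem_Icc (u : ℝ) : D.comb'' u ∈ Icc (-(1 - D.p.t)) D.p.t :=
  sum_translate_mem_Icc D.cell_eq_zero (by linarith [D.p.ht1]) D.p.ht.le D.p.cell_mem_Icc _ _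

/-- `gₙ'' = t` on the positive plateaus. [cite: ChoffrutSzekelyhidi2014, Lemma 4] -/
theorem comb''_eq_pos {u : ℝ} {k : ℤ} (hk : k ∈ D.Kset)
    (hu : D.M * u - k ∈ Icc (D.p.α₂ + D.p.κ) D.p.β₂) : D.comb'' u = D.p.t := by
  obtain ⟨hps1, hps2, hps3, hps4⟩ := D.p.plateaus_subset
  have := D.p.α₁_pos; have := D.p.α₁_le_β₁; have := D.p.α₂_le_β₂; have := D.p.α₃_le_β₃
  have := D.p.β₃_lt_one; have := D.p.κ_pos; have := D.p.β₁_lt_α₂; have := D.p.β₂_lt_α₃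
  have := D.p.β₃_add
  unfold comb''
  rw [sum_translate_eq_of_mem D.cell_eq_zero hk ⟨by linarith [hu.1], by linarith [hu.2]⟩]
  exact D.p.cell_eq_pos hu.1 hu.2

/-- `gₙ'' = -(1-t)` on the first negative plateaus. [cite: ChoffrutSzekelyhidi2014, Lemma 4] -/
theorem comb''_eq_neg₁ {u : ℝ} {k : ℤ} (hk : k ∈ D.Kset)
    (hu : D.M * u - k ∈ Icc (D.p.α₁ + D.p.κ) D.p.β₁) : D.comb'' u = -(1 - D.p.t) := by
  obtain ⟨hps1, hps2, hps3, hps4⟩ := D.p.plateaus_subset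
  have := D.p.α₁_pos; have := D.p.α₁_le_β₁; have := D.p.α₂_le_β₂; have := D.p.α₃_le_β₃
  have := D.p.β₃_lt_one; have := D.p.κ_pos; have := D.p.β₁_lt_α₂; have := D.p.β₂_lt_α₃
  have := D.p.β₃_add
  unfold comb''
  rw [sum_translate_eq_of_mem D.cell_eq_zero hk ⟨by linarith [hu.1], by linarith [hu.2]⟩]
  exact D.p.cell_eq_neg₁ hu.1 hu.2

/-- `gₙ'' = -(1-t)` on the second negative plateaus. [cite: ChoffrutSzekelyhidi2014, Lemma 4] -/
theorem comb''_eq_neg₃ {u : ℝ} {k : ℤ} (hk : k ∈ D.Kset)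
    (hu : D.M * u - k ∈ Icc (D.p.α₃ + D.p.κ) D.p.β₃) : D.comb'' u = -(1 - D.p.t) := by
  obtain ⟨hps1, hps2, hps3, hps4⟩ := D.p.plateaus_subset
  have := D.p.α₁_pos; have := D.p.α₁_le_β₁; have := D.p.α₂_le_β₂; have := D.p.α₃_le_β₃
  have := D.p.β₃_lt_one; have := D.p.κ_pos; have := D.p.β₁_lt_α₂; have := D.p.β₂_lt_α₃
  have := D.p.β₃_add
  unfold comb''
  rw [sum_translate_eq_of_mem D.cell_eq_zero hk ⟨by linarith [hu.1], by linarith [hu.2]⟩]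
  exact D.p.cell_eq_neg₃ hu.1 hu.2

/-! ## The cutoff -/

/-- The one-dimensional plateau `B = 1` on `[1/q, 1-1/q]`, `= 0` off `(1/(2q), 1-1/(2q))`. [folklore] -/
def plat (θ : ℝ) : ℝ := Profile.bump (1 / (2 * D.q)) (1 - 1 / D.q) (1 / (2 * D.q)) θ

/-- `1/(2q) > 0`. [folklore] -/
theorem hw_pos : 0 < 1 / (2 * (D.q : ℝ)) := by have := D.q_pos; positivity

/-- `1/(2q) ≤ 1 - 1/q` (as `q ≥ 3`). [folklore] -/
theorem hw_le : 1 / (2 * (D.q : ℝ)) ≤ 1 - 1 / D.q := by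
  have hq : (3 : ℝ) ≤ D.q := by exact_mod_cast D.hq
  rw [div_le_iff₀ (by linarith), sub_mul, one_div_mul_eq_div, div_eq_mul_inv]
  nlinarith [mul_inv_cancel₀ (show (D.q : ℝ) ≠ 0 by linarith)]

/-- `plat` is smooth. [folklore] -/
theorem contDiff_plat : ContDiff ℝ ∞ D.plat := Profile.contDiff_bump _ _ _

/-- `0 ≤ plat ≤ 1`. [folklore] -/
theorem plat_mem_Icc (θ : ℝ) : D.plat θ ∈ Icc (0 : ℝ) 1 :=
  ⟨Profile.bump_nonneg D.hw_le D.hw_pos θ, Profile.bump_le_one θ⟩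

/-- `plat = 1` on `[1/q, 1 - 1/q]`. [folklore] -/
theorem plat_eq_one {θ : ℝ} (h1 : 1 / (D.q : ℝ) ≤ θ) (h2 : θ ≤ 1 - 1 / D.q) : D.plat θ = 1 := by
  have : 1 / (2 * (D.q : ℝ)) + 1 / (2 * D.q) = 1 / D.q := by
    have hq : (D.q : ℝ) ≠ 0 := by exact_mod_cast D.q_pos.ne'
    field_simp; ring
  exact Profile.bump_eq_one D.hw_pos (by linarith) h2

/-- `plat` vanishes off `(1/(2q), 1 - 1/(2q))`. [folklore] -/
theorem plat_eq_zero {θ : ℝ} (h : θ ≤ 1 / (2 * (D.q : ℝ)) ∨ 1 - 1 / (2 * (D.q : ℝ)) ≤ θ) : D.plat θ = 0 := by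
  rcases h with h | h
  · exact Profile.bump_eq_zero_of_le D.hw_le D.hw_pos h
  · refine Profile.bump_eq_zero_of_ge D.hw_le D.hw_pos ?_
    have : 1 - 1 / (D.q : ℝ) + 1 / (2 * D.q) = 1 - 1 / (2 * D.q) := by
      have hq : (D.q : ℝ) ≠ 0 := by exact_mod_cast D.q_pos.ne'
      field_simp; ring
    linarith

variable [DecidableEq d]

/-- The Householder frame. [folklore] -/
def R : Ed d ≃ₗᵢ[ℝ] Ed d := houseR D.i₀ D.c.η

/-- The phase in the frame: `⟪η, x⟫ = (R x)_{i₀}`. [folklore] -/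
theorem phase_eq (x : Ed d) : phase D.c.η x = D.R x D.i₀ :=
  inner_eq_houseR_apply D.i₀ D.hη x

/-- The cutoff `χ(x) = Πᵢ B((R x)ᵢ)`. [cite: ChoffrutSzekelyhidi2014, Lemma 4] -/
def χ (x : Ed d) : ℝ := ∏ i, D.plat (D.R x i)

/-- The cutoff is smooth. [folklore] -/
theorem contDiff_χ : ContDiff ℝ ∞ D.χ := by
  unfold χ
  refine contDiff_prod fun i _ => D.contDiff_plat.comp ?_
  exact (PiLp.proj 2 (𝕜 := ℝ) (fun _ : d => ℝ) i).contDiff.comp D.R.toContinuousLinearEquiv.contDiff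

/-- `0 ≤ χ ≤ 1`. [folklore] -/
theorem χ_mem_Icc (x : Ed d) : D.χ x ∈ Icc (0 : ℝ) 1 := by
  unfold χ
  exact ⟨Finset.prod_nonneg fun i _ => (D.plat_mem_Icc _).1,
    Finset.prod_le_one (fun i _ => (D.plat_mem_Icc _).1) fun i _ => (D.plat_mem_Icc _).2⟩

/-- The plateau of the cutoff: `{x | ∀ i, (R x)ᵢ ∈ (1/q, 1 - 1/q)}`. [folklore] -/
def plateau : Set (Ed d) := {x | ∀ i, D.R x i ∈ Ioo (1 / (D.q : ℝ)) (1 - 1 / D.q)}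

/-- The plateau is open. [folklore] -/
theorem isOpen_plateau : IsOpen D.plateau := by
  have : D.plateau = ⋂ i, (fun x => D.R x i) ⁻¹' Ioo (1 / (D.q : ℝ)) (1 - 1 / D.q) := by
    ext x; simp [plateau]
  rw [this]
  exact isOpen_iInter_of_finite fun i => isOpen_Ioo.preimage (by
    exact ((PiLp.proj 2 (𝕜 := ℝ) (fun _ : d => ℝ) i).continuous.comp D.R.continuous))

/-- `χ = 1` on the plateau. [folklore] -/
theorem χ_eq_one {x : Ed d} (hx : x ∈ D.plateau) : D.χ x = 1 := by
  unfold χ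
  exact Finset.prod_eq_one fun i _ => D.plat_eq_one (hx i).1.le (hx i).2.le

/-- `χ` is eventually `1` near points of the plateau. [folklore] -/
theorem χ_eventuallyEq_one {x : Ed d} (hx : x ∈ D.plateau) : D.χ =ᶠ[nhds x] fun _ => 1 :=
  Filter.eventually_of_mem (D.isOpen_plateau.mem_nhds hx) fun _ hy => D.χ_eq_one hy

/-- The closed box carrying the support of the cutoff. [folklore] -/
def suppBox : Set (Ed d) := {x | ∀ i, D.R x i ∈ Icc (1 / (2 * (D.q : ℝ))) (1 - 1 / (2 * D.q))}

/-- `χ` vanishes off the support box. [folklore] -/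
theorem χ_eq_zero {x : Ed d} (hx : x ∉ D.suppBox) : D.χ x = 0 := by
  simp only [suppBox, mem_setOf_eq, not_forall, mem_Icc, not_and_or, not_le] at hx
  obtain ⟨i, hi⟩ := hx
  unfold χ
  exact Finset.prod_eq_zero (Finset.mem_univ i) (D.plat_eq_zero (hi.imp le_of_lt le_of_lt))

/-- The support box is closed. [folklore] -/
theorem isClosed_suppBox : IsClosed D.suppBox := by
  have : D.suppBox = ⋂ i, (fun x => D.R x i) ⁻¹' Icc (1 / (2 * (D.q : ℝ))) (1 - 1 / (2 * D.q)) := by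
    ext x; simp [suppBox]
  rw [this]
  exact isClosed_iInter fun i => isClosed_Icc.preimage
    ((PiLp.proj 2 (𝕜 := ℝ) (fun _ : d => ℝ) i).continuous.comp D.R.continuous)

/-- The support box lies in the reference cube. [folklore] -/
theorem suppBox_subset : D.suppBox ⊆ refCube D.R := by
  intro x hx
  rw [mem_refCube, mem_box]
  intro i
  have hw := D.hw_pos
  exact ⟨lt_of_lt_of_le hw (hx i).1, lt_of_le_of_lt (hx i).2 (by linarith)⟩

/-- `tsupport χ ⊆ suppBox`. [folklore] -/
theorem tsupport_χ_subset : tsupport D.χ ⊆ D.suppBox :=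
  closure_minimal (fun _ hx => by_contra fun h => hx (D.χ_eq_zero h)) D.isClosed_suppBox

/-- `χ` has compact support. [folklore] -/
theorem hasCompactSupport_χ : HasCompactSupport D.χ :=
  (isCompact_closedBall (0 : Ed d) _).of_isClosed_subset (isClosed_tsupport _)
    ((D.tsupport_χ_subset.trans D.suppBox_subset).trans (refCube_subset_closedBall D.R))

/-! ## The potential and its field -/

/-- **The potential** `φₙ = χ · gₙ(⟪η, ·⟫)`. [cite: ChoffrutSzekelyhidi2014, Lemma 4] -/
def pot (x : Ed d) : ℝ := D.χ x * D.comb (phase D.c.η x)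

/-- The potential is smooth. [folklore] -/
theorem contDiff_pot : ContDiff ℝ ∞ D.pot := D.contDiff_χ.mul (contDiff_comp_phase D.contDiff_comb _)

/-- `tsupport φₙ ⊆ tsupport χ ⊆ refCube`. [folklore] -/
theorem tsupport_pot_subset : tsupport D.pot ⊆ refCube D.R :=
  ((tsupport_mul_subset_left : tsupport D.pot ⊆ tsupport D.χ).trans D.tsupport_χ_subset).trans
    D.suppBox_subset

/-- The potential has compact support. [folklore] -/
theorem hasCompactSupport_pot : HasCompactSupport D.pot := D.hasCompactSupport_χ.mul_right

/-- **The field** `Wₙ = 𝓛_w̄[φₙ]`. [cite: ChoffrutSzekelyhidi2014, Lemma 4] -/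
def W : Ed d → State d := D.c.field D.pot

/-- **Decomposition of the field**: `Wₙ(x) = (χ(x) gₙ''(⟪η,x⟫)) • w̄ + rem`. [cite: ChoffrutSzekelyhidi2014, Lemma 4] -/
theorem W_eq (x : Ed d) : D.W x = (D.χ x * D.comb'' (phase D.c.η x)) • D.c.dir + D.c.rem D.χ D.comb x := by
  unfold W pot
  rw [D.c.field_mul_comp_phase D.contDiff_χ D.contDiff_comb, D.deriv_deriv_comb]

/-- The scalar amplitude `χ gₙ''` lies in `[-(1-t), t]`. [folklore] -/
theorem amp_mem_Icc (x : Ed d) : D.χ x * D.comb'' (phase D.c.η x) ∈ Icc (-(1 - D.p.t)) D.p.t := by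
  obtain ⟨h0, h1⟩ := D.χ_mem_Icc x
  obtain ⟨g0, g1⟩ := D.comb''_mem_Icc (phase D.c.η x)
  have ht := D.p.ht; have ht1 := D.p.ht1
  constructor <;> nlinarith

/-- **On the plateau the field is the exact plane wave** `gₙ''(⟪η,x⟫) • w̄`. [cite: ChoffrutSzekelyhidi2014, Lemma 4] -/
theorem W_eq_of_mem_plateau {x : Ed d} (hx : x ∈ D.plateau) : D.W x = D.comb'' (phase D.c.η x) • D.c.dir := by
  have hrem : D.c.rem D.χ D.comb x = 0 :=
    D.c.rem_eq_zero_of (fun k => (WaveCert.pd_eq_zero_of_eventuallyEq_const (D.χ_eventuallyEq_one hx) _ (eb k)).1)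
      fun k l => (WaveCert.pd_eq_zero_of_eventuallyEq_const (D.χ_eventuallyEq_one hx) _ _).2
  rw [D.W_eq, hrem, add_zero, D.χ_eq_one hx, one_mul]

/-! ## The level sets -/

/-- The positive level set `A_r`: plateau points whose phase sits on a positive cell plateau.
[cite: ChoffrutSzekelyhidi2014, Lemma 4] -/
def Apos : Set (Ed d) :=
  D.plateau ∩ ⋃ k ∈ D.Kset, (fun x : Ed d => ((D.M : ℝ) * D.R x D.i₀ - k : ℝ)) ⁻¹' Ioo (D.p.α₂ + D.p.κ) D.p.β₂

/-- The negative level set `A_l`. [cite: ChoffrutSzekelyhidi2014, Lemma 4] -/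
def Aneg : Set (Ed d) :=
  D.plateau ∩ ⋃ k ∈ D.Kset, ((fun x : Ed d => ((D.M : ℝ) * D.R x D.i₀ - k : ℝ)) ⁻¹' Ioo (D.p.α₁ + D.p.κ) D.p.β₁ ∪
    (fun x : Ed d => ((D.M : ℝ) * D.R x D.i₀ - k : ℝ)) ⁻¹' Ioo (D.p.α₃ + D.p.κ) D.p.β₃)

/-- **`Wₙ = t • w̄` on `A_r`.** [cite: ChoffrutSzekelyhidi2014, Lemma 4 (ii)] -/
theorem W_eq_pos {x : Ed d} (hx : x ∈ D.Apos) : D.W x = D.p.t • D.c.dir := by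
  obtain ⟨hpl, hx⟩ := hx
  obtain ⟨k, hk, hu⟩ := mem_iUnion₂.1 hx
  rw [D.W_eq_of_mem_plateau hpl, D.phase_eq, D.comb''_eq_pos hk ⟨hu.1.le, hu.2.le⟩]

/-- **`Wₙ = -(1-t) • w̄` on `A_l`.** [cite: ChoffrutSzekelyhidi2014, Lemma 4 (ii)] -/
theorem W_eq_neg {x : Ed d} (hx : x ∈ D.Aneg) : D.W x = (-(1 - D.p.t)) • D.c.dir := by
  obtain ⟨hpl, hx⟩ := hx
  obtain ⟨k, hk, hu⟩ := mem_iUnion₂.1 hx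
  rw [D.W_eq_of_mem_plateau hpl, D.phase_eq]
  rcases hu with hu | hu
  · rw [D.comb''_eq_neg₁ hk ⟨hu.1.le, hu.2.le⟩]
  · rw [D.comb''_eq_neg₃ hk ⟨hu.1.le, hu.2.le⟩]

/-- Continuity of the frame coordinates. [folklore] -/
theorem continuous_R_apply (i : d) : Continuous fun x : Ed d => (D.R x i : ℝ) :=
  (PiLp.proj 2 (𝕜 := ℝ) (fun _ : d => ℝ) i).continuous.comp D.R.continuous

/-- Continuity of the rescaled shifted phase. [folklore] -/
theorem continuous_Mphase (k : ℤ) : Continuous fun x : Ed d => ((D.M : ℝ) * D.R x D.i₀ - k : ℝ) :=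
  (continuous_const.mul (D.continuous_R_apply D.i₀)).sub continuous_const

/-- `A_r` is open. [folklore] -/
theorem isOpen_Apos : IsOpen D.Apos :=
  D.isOpen_plateau.inter (isOpen_biUnion fun k _ => isOpen_Ioo.preimage (D.continuous_Mphase k))

/-- `A_l` is open. [folklore] -/
theorem isOpen_Aneg : IsOpen D.Aneg :=
  D.isOpen_plateau.inter (isOpen_biUnion fun k _ =>
    (isOpen_Ioo.preimage (D.continuous_Mphase k)).union (isOpen_Ioo.preimage (D.continuous_Mphase k)))

/-- The plateau lies in the reference cube. [folklore] -/
theorem plateau_subset : D.plateau ⊆ refCube D.R := by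
  intro x hx
  rw [mem_refCube, mem_box]
  intro i
  have hq : (0 : ℝ) < 1 / D.q := by have := D.q_pos; positivity
  exact ⟨hq.trans (hx i).1, (hx i).2.trans (by linarith)⟩

/-- `A_r ⊆ refCube`. [folklore] -/
theorem Apos_subset : D.Apos ⊆ refCube D.R := fun _ hx => D.plateau_subset hx.1

/-- `A_l ⊆ refCube`. [folklore] -/
theorem Aneg_subset : D.Aneg ⊆ refCube D.R := fun _ hx => D.plateau_subset hx.1

/-- `A_l` and `A_r` are disjoint (the field takes different values there, as `w̄ ≠ 0`; we argue
directly through the cell structure). [folklore] -/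
theorem disjoint_Aneg_Apos : Disjoint D.Aneg D.Apos := by
  rw [Set.disjoint_left]
  rintro x ⟨-, hx⟩ ⟨-, hx'⟩
  obtain ⟨k, hk, hu⟩ := mem_iUnion₂.1 hx
  obtain ⟨k', hk', hu'⟩ := mem_iUnion₂.1 hx'
  simp only [mem_preimage, mem_union] at hu hu'
  obtain ⟨hps1, hps2, hps3, hps4⟩ := D.p.plateaus_subset
  have h12 := D.p.α₁_le_β₁; have h23 := D.p.α₂_le_β₂; have h34 := D.p.α₃_le_β₃
  have := D.p.α₁_pos; have := D.p.β₃_lt_one; have := D.p.κ_pos; have := D.p.β₁_lt_α₂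
  have := D.p.β₂_lt_α₃; have := D.p.β₃_add
  set v := (D.M : ℝ) * D.R x D.i₀
  -- both `v - k` and `v - k'` lie in `(0,1)`, so `k = k'`
  have hI : ∀ {j : ℤ} {a b : ℝ}, v - j ∈ Ioo a b → 0 < a → b < 1 → ⌊v⌋ = j := by
    intro j a b h ha hb
    rw [Int.floor_eq_iff]; constructor <;> linarith [h.1, h.2]
  have hk1 : ⌊v⌋ = k' := hI hu' (by linarith) (by linarith)
  rcases hu with hu | hu
  · have hk2 : ⌊v⌋ = k := hI hu (by linarith) (by linarith)
    have : k = k' := hk2.symm.trans hk1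
    subst this
    linarith [hu.2, hu'.1]
  · have hk2 : ⌊v⌋ = k := hI hu (by linarith) (by linarith)
    have : k = k' := hk2.symm.trans hk1
    subst this
    linarith [hu.1, hu'.2]

/-! ## Values near the segment -/

/-- **Uniform smallness of the remainder**: for every `δ > 0` there is `n₀` such that the data
with `n ≥ n₀` (all other parameters fixed) have `‖Wₙ(x) - (χ gₙ'') • w̄‖ ≤ δ` everywhere. We
phrase it for a fixed datum through an explicit bound in `1/M`. [cite: ChoffrutSzekelyhidi2014, Lemma 4 (i)] -/
theorem norm_rem_le [Nonempty d] {M₁ M₂ K : ℝ} (hM₁ : ∀ k x, |pd (eb k) D.χ x| ≤ M₁)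
    (hM₂ : ∀ k l x, |pd (eb k) (pd (eb l) D.χ) x| ≤ M₂) (hK0 : 0 ≤ K)
    (hK : ∀ θ, |D.p.cellPot θ| ≤ K ∧ |D.p.cellInt θ| ≤ K) (x : Ed d) :
    ‖D.c.rem D.χ D.comb x‖ ≤ D.c.coefBound * (M₂ * (K / (D.M : ℝ) ^ 2) + 2 * (M₁ * 1) * (K / D.M)) := by
  have h := D.c.norm_rem_le (χ := D.χ) (G := D.comb) (x := x) (B₁ := K / D.M) (fun k => hM₁ k x)
    (fun k l => hM₂ k l x) (D.abs_comb_le hK0 (fun θ => (hK θ).1) _)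
    (by rw [D.deriv_comb]; exact D.abs_comb'_le hK0 (fun θ => (hK θ).2) _)
  rwa [D.hη] at h

end TwoStateData

end StationaryEuler

end Literature.Analysis.FluidPDE
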